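import Mathlib
import HarnessLib
import HarnessLib.Audit
import Summits.NavierStokesRegularity.Statement
import Literature.Analysis.FluidPDE.TaoAveragedEuler
import Literature.Analysis.FluidPDE.ClassicalSolution
import Literature.Analysis.FluidPDE.LerayHopf
import Summits.NavierStokesRegularity.NavierStokesRegularity.Theorems.MonotoneCriticalInterfaceAveraged
import Literature.Analysis.FluidPDE.CriticalSpaces
import Literature.Analysis.FluidPDE.NSCriticalClosure
import Literature.Analysis.FunctionSpaces.LittlewoodPaley
import Summits.NavierStokesRegularity.NavierStokesRegularity.Theorems.TypeICertificateLadderNoBlowupToClay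

/-!
Route: MonotoneCritical

CLOSED (superseded) 2026-08-15T12:55:52Z by planner-NavierStokesRegularity-route-NavierStokesRegularity-MonotoneCritical-0 — reason: superseded:route-NavierStokesRegularity-QuasipotentialCoercivity — superseded by route-NavierStokesRegularity-QuasipotentialCoercivity — note: ROUTE-REPAIR VERDICT (planner rrepair-866a980a, 2026-08-15): CLOSE AS SUPERSEDED by route-NavierStokesRegularity-QuasipotentialCoercivity (gen-0 umbrella → gen-1 mechanism routes). CENSUS. (1) The thesis never became typable as filed: def Literature.NS.CriticalLyapunov bounced (p2880, 08-13 06:56Z, . The file is kept as the record of this route; refuted decls are indexed as negative knowledge (`ledger negatives`).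

# Route MonotoneCritical — NavierStokesRegularity (Clay A), positive side; POSITS A NEW OBJECT

## Thesis X
In words: there exists a CRITICAL LYAPUNOV FUNCTIONAL for 3-D Navier–Stokes — a functional M on
divergence-free
fields, finite on Clay data, (almost) non-increasing along every finite-energy classical solution,
and coercive:
it controls a critical norm whose boundedness is known to prevent blow-up (L³: ESS2003/Seregin2012;
or any
Ḃ^{-1+3/p}_{p,q} with 3<p,q<∞: GKP2016, Albritton 2018).
Lean: `Nonempty Literature.NS.CriticalLyapunov` — notion missing; definition request filed
(interface below). Existence is a
separate CONSTRUCTION item; nothing about existence is put in the interface.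

Interface `structure Literature.NS.CriticalLyapunov` (target
Summits/NavierStokesRegularity/Theorems/MonotoneCritical/):
  M : (ℝ³ → ℝ³) → ℝ≥0∞;  F : ℝ≥0∞ → ℝ → ℝ≥0∞ with F m t < ⊤ for m < ⊤;  G : ℝ≥0∞ → ℝ≥0∞ with G m < ⊤
for m < ⊤;
  finite : ∀ v, ContDiff ℝ ∞ v → IsDivFree v → HasRapidSpatialDecay v → M v < ⊤;
  almostMonotone : ∀ ν T u p, 0<ν → 0<T → IsClassicalNSSolutionOn (Ico 0 T) ν 0 u p → IsLerayHopfOn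
T ν 0 (u 0) u →
      HasRapidSpatialDecay (u 0) → ∀ t ∈ Ico 0 T, M (u t) ≤ F (M (u 0)) t      (ν may be fixed to 1
by scaling);
  coercive : ∀ v (Schwartz, div-free), eLpNorm v 3 volume ≤ G (M v)   [variant: a Besov
Ḃ^{-1+3/p}_{p,q} norm, 3<p,q<∞].

## Assembly X → NavierStokesRegularity
instance ⇒ sup_{t<T} ‖u(t)‖_{L³} < ⊤ on any [0,T) ⇒ (crux #3, ESS shape) HasSmoothExtensionPast ⇒
NoBlowup
(= stmt-NavierStokesRegularity-0054, route TypeILiouville) ⇒ A via stmt-…-0055. Assembly item here: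
instance → NoBlowup.

## Why this line
Every known unconditional a-priori bound for NS is supercritical (energy: ½ derivative below
scaling), every
regularity criterion is critical (LPS Prodi1959/Serrin1963, ESS/Seregin2012, GKP2016, KochTataru2001
small data);
the problem IS the half-derivative gap. This route imports the Lyapunov/monotonicity-formula method
(dynamical
systems; cf. monotone quantities for geometric heat flows) and asks for the object directly, as an
interface whose
axioms are exactly what the closing theorems consume. Tao2016 (averaged NS blows up) is the sharp
barrier and is
filed as the NEGATIVE companion item: any M whose monotonicity uses only the energy identity
⟨B(u,u),u⟩ = 0,
scaling and Littlewood–Paley-type bounds on B would work verbatim for Tao's averaged bilinear B̃ and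
contradict
`Literature.Analysis.FluidPDE.tao_averaged_ns_blowup`; so a genuine instance must see NS-specific
structure (vorticity geometry
ConstantinFefferman1993, helicity, pressure Hessian, Kelvin circulation). That is the informative
content either way.

## Ranked cruxes
#2 CONSTRUCTION: an instance of CriticalLyapunov exists (informal; needs_definition
CriticalLyapunov). Hardest.
#3 Closure, ESS shape (elaborates): uniform L³ bound on [0,T) for a finite-energy classical solution
from Clay data ⇒
   HasSmoothExtensionPast (ESS2003 Thm 1.4 via
`Literature.Analysis.FluidPDE.ess_endpoint`/`seregin_L3_blowup`; expected Literature fact).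
#4 BARRIER (negative companion, informal; needs_definition CriticalLyapunovFor B): for Tao's
averaged bilinear B̃ with
   cancellation no CriticalLyapunovFor B̃ exists — immediate from tao_averaged_ns_blowup + local
theory once
   the B-parametrised interface is written; documents which axioms an instance must violate for B̃.
#5 Closure, Besov shape (elaborates): uniform Ḃ^{-1+3/p}_{p,q} bound (3<p,q<∞) ⇒ extension (GKP2016;
weakest
   admissible coercivity; Ḃ^{-1}_{∞,∞} would NOT suffice by current knowledge — only
Cheskidov–Shvydkoy small jumps).

## Kill criteria
- A proof that axioms (finite, almostMonotone, coercive) are jointly inconsistent with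
`chae_wolf_dss_existence`-type
  large forward self-similar solutions or with known norm-inflation (Bourgain–Pavlović in
Ḃ^{-1}_{∞,∞}) — none known.
- Blow-up (routes Blowup/CertifiedBlowup) kills all positive routes.
- If #4's analysis shows every candidate functional built from currently available NS-specific
identities is
  non-coercive, downgrade to closed with note.

## NOT decomposed
Which candidate M (modulated critical energy, Constantin depletion-weighted enstrophy,
profile-decomposition
minimal energy); quantitative forms (Tao2021) of #3; the ν-scaling normalisation inside the
interface.

Rationale: Posit a critical Lyapunov functional (interface + separate construction item); ESS/GKP close; Tao
averaged-NS blow-up filed as the negative companion/barrier.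

History (route lifecycle, newest last):
- 2026-08-15T12:55:52Z · CLOSED superseded — superseded:route-NavierStokesRegularity-QuasipotentialCoercivity (planner-NavierStokesRegularity-route-NavierStokesRegularity-)

sub-problem: NavierStokesRegularity · status: closed(superseded) · opened planner-NavierStokesRegularity-Survey-0 2026-08-13T06:03:49Z · rev 0 · ledger route-NavierStokesRegularity-MonotoneCritical
GENERATED by the gate from the ledger (D-0016/17). Provers cite these decls: `theorem foo : Summit.NavierStokesRegularity.NavierStokesRegularity.Theses.MonotoneCritical.<Decl> := …` in Summits/NavierStokesRegularity/NavierStokesRegularity/Theorems/<Name>.lean.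
-/

namespace Summit.NavierStokesRegularity.NavierStokesRegularity.Theses.MonotoneCritical

open scoped BigOperators Topology Manifold Classical MeasureTheory ProbabilityTheory Matrix InnerProductSpace ComplexConjugate ContinuousMap
open Filter Set Function TopologicalSpace MeasureTheory

attribute [summit_statement] _root_.NavierStokesRegularity

open Literature.NS

-- TODO item stmt-NavierStokesRegularity-0060 · crux · rank 0 · closed · moot by None · by planner — BLOCKED: missing decl(s) Literature.NS.CriticalLyapunov; restate via `ledger route edit` once they land:
--   def MonotoneCriticalThesis : Prop := Nonempty Literature.NS.CriticalLyapunov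

-- item stmt-NavierStokesRegularity-0062 · crux · rank 2 · closed · moot by None · by planner — informal only, no Lean statement yet:
--   Construct M,F,G satisfying the CriticalLyapunov axioms. By the barrier item (#4) M must use
--   NS-specific structure absent from Tao's averaged equations (vorticity stretching geometry, helicity,
--   pressure Hessian identities, circulation). Candidates deliberately not fixed. structure
--   Literature.NS.CriticalLyapunov := (M : (ℝ³→ℝ³) → ℝ≥0∞) (F : ℝ≥0∞ → ℝ → ℝ≥0∞, finite on finite×ℝ) (G
--   : ℝ≥0∞ → ℝ≥0∞, finite on finite) (finite : Schwartz div-free v ⇒ M v < ⊤) (almostMonotone : along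
--   every finite-energy classical solution from Clay data on [0,T), M (u t) ≤ F (M (u 0)) t) (coercive :
--   eLpNorm v 3 ≤ G (M v

/-- item stmt-NavierStokesRegularity-0063 · support · rank 3 · closed · proved by Summit.NavierStokesRegularity.NavierStokesRegularity.Theorems.monotoneCritical_monotoneCriticalL3Closure_proof (prover) · by planner
Escauriaza–Seregin–Šverák 2003 Thm 1.4 / Seregin 2012 Thm 1.1 in the classical finite-energy
setting: if sup_{0≤t<T} ‖u(t)‖_{L³} < ∞ then T is not a blow-up time. Expected to follow from the
named facts Literature.Analysis.FluidPDE.ess_endpoint /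
Literature.Analysis.FluidPDE.seregin_L3_blowup plus LPS smoothing; grounder may restate with (h :
ess_endpoint). [sources: Seregin2012, Prodi1959, Serrin1963, RobinsonRodrigoSadowski2016] -/
@[route_item "route-NavierStokesRegularity-MonotoneCritical"]
def MonotoneCriticalL3Closure : Prop :=
  ∀ (ν T : ℝ), 0 < ν → 0 < T → ∀ (u : ℝ → EuclideanSpace ℝ (Fin 3) → EuclideanSpace ℝ (Fin 3)) (p : ℝ → EuclideanSpace ℝ (Fin 3) → ℝ), Literature.Analysis.FluidPDE.IsClassicalNSSolutionOn (Set.Ico 0 T) ν 0 u p → Literature.Analysis.FluidPDE.IsLerayHopfOn T ν 0 (u 0) u → Literature.Analysis.FluidPDE.HasRapidSpatialDecay (u 0) → (⨆ t ∈ Set.Ico 0 T, MeasureTheory.eLpNorm (u t) 3 MeasureTheory.volume) < ⊤ → Literature.Analysis.FluidPDE.HasSmoothExtensionPast ν 0 u T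

-- `MonotoneCriticalL3Closure` holds: proved by `Summit.NavierStokesRegularity.NavierStokesRegularity.Theorems.monotoneCritical_monotoneCriticalL3Closure_proof` (its module imports this route file, so no `_holds` link can be stated here).

/-- item stmt-NavierStokesRegularity-0064 · support · rank 4 · closed · moot by None · by planner
Let CriticalLyapunovFor B be the same interface with 'classical NS solution' replaced by 'H¹⁰_df
mild solution of ∂ₜu = Δu + B(u,u)' (Literature.Analysis.FluidPDE.IsGlobalH10MildSolution shape).
Claim: ∃ B, Literature.Analysis.FluidPDE.IsAveragedEulerBilinear B ∧
Literature.Analysis.FluidPDE.HasCancellation B ∧ IsEmpty (CriticalLyapunovFor B). Proof sketch: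
Literature.Analysis.FluidPDE.tao_averaged_ns_blowup gives B̃ and a Schwartz datum without global H¹⁰
mild solution; an instance would bound a critical norm uniformly on the maximal interval, and the
L³/Besov continuation criterion holds for averaged equations (same harmonic-analysis proof),
contradiction. Value: pins down which NS-specific structure any instance in #2 must exploit.
[sources: Tao2016, arXiv:1402.0290] [needs_definition: Literature.NS.CriticalLyapunovFor] -/
@[route_item "route-NavierStokesRegularity-MonotoneCritical"]
def MonotoneCriticalTaoBarrier : Prop :=
  ∃ B : (EuclideanSpace ℝ (Fin 3) → EuclideanSpace ℝ (Fin 3)) → (EuclideanSpace ℝ (Fin 3) → EuclideanSpace ℝ (Fin 3)) → EuclideanSpace ℝ (Fin 3) → EuclideanSpace ℝ (Fin 3), Literature.Analysis.FluidPDE.IsAveragedEulerBilinear B ∧ Literature.Analysis.FluidPDE.HasCancellation B ∧ IsEmpty (Literature.NS.CriticalLyapunovFor B)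

/-- item stmt-NavierStokesRegularity-0065 · support · rank 5 · closed · moot by None · by planner
Gallagher–Koch–Planchon 2016 Thm 1 (limsup form) / Albritton 2018 (limit form): a critical Besov
norm with 3<p,q<∞ must blow up at a singular time; contrapositive in the classical finite-energy
setting. This is the weakest coercivity the interface may use. Expected to reduce to the tree's
Literature.Analysis.FluidPDE.gkp_besov_blowup (currently sorry'd theorem in CriticalRegularity.lean)
plus identification of the classical solution with the maximal Besov mild solution. [sources:
GKP2016, GallagherKochPlanchon2016, BahouriCheminDanchin2011] -/
@[route_item "route-NavierStokesRegularity-MonotoneCritical"]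
def MonotoneCriticalBesovClosure : Prop :=
  ∀ (ν T : ℝ), 0 < ν → 0 < T → ∀ (u : ℝ → EuclideanSpace ℝ (Fin 3) → EuclideanSpace ℝ (Fin 3)) (p : ℝ → EuclideanSpace ℝ (Fin 3) → ℝ) (U : ℝ → TemperedDistribution (EuclideanSpace ℝ (Fin 3)) (EuclideanSpace ℂ (Fin 3))) (r q : ENNReal) [Fact (1 ≤ r)], 3 < r → r < ⊤ → 3 < q → q < ⊤ → Literature.Analysis.FluidPDE.IsClassicalNSSolutionOn (Set.Ico 0 T) ν 0 u p → Literature.Analysis.FluidPDE.IsLerayHopfOn T ν 0 (u 0) u → Literature.Analysis.FluidPDE.HasRapidSpatialDecay (u 0) → (∀ t ∈ Set.Ico 0 T, Literature.Analysis.FluidPDE.IsDistributionOf (u t) (U t)) → (⨆ t ∈ Set.Ico 0 T, Literature.Analysis.FunctionSpaces.eHomBesovNorm (-1 + 3 / r.toReal) r q (U t)) < ⊤ → Literature.Analysis.FluidPDE.HasSmoothExtensionPast ν 0 u T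

/-- item stmt-NavierStokesRegularity-0055 · assembly · rank 1 · closed · proved by Summit.NavierStokesRegularity.NavierStokesRegularity.Theorems.typeICertificateLadder_noBlowupToClay_proof @ 8d57e70af7e2 (prover) · by planner
Given NoBlowup, build the Clay (A) solution: local finite-energy classical solution for smooth
divergence-free rapidly decaying data (Leray 1934 §III / Fujita–Kato 1964 + LPS smoothing), continue
past every T using NoBlowup, glue by weak–strong uniqueness (Prodi–Serrin), bounded energy from the
energy inequality, and convert with
Literature.Analysis.FluidPDE.isNavierStokesSolution_and_smooth_iff. Blow-up at spatial infinity is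
excluded by CKN ε-regularity applied far out. May take named Literature facts (leray_existence_R3,
ladyzhenskaya_prodi_serrin, weak_strong_uniqueness, fujita_kato_local) as hypotheses if the grounder
so rules. -/
@[route_item "route-NavierStokesRegularity-MonotoneCritical"]
def Assembly : Prop :=
  (∀ (ν T : ℝ), 0 < ν → 0 < T → ∀ (u : ℝ → EuclideanSpace ℝ (Fin 3) → EuclideanSpace ℝ (Fin 3)) (p : ℝ → EuclideanSpace ℝ (Fin 3) → ℝ), Literature.Analysis.FluidPDE.IsClassicalNSSolutionOn (Set.Ico 0 T) ν 0 u p → Literature.Analysis.FluidPDE.IsLerayHopfOn T ν 0 (u 0) u → Literature.Analysis.FluidPDE.HasRapidSpatialDecay (u 0) → Literature.Analysis.FluidPDE.HasSmoothExtensionPast ν 0 u T) → NavierStokesRegularity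

/-- `Assembly` holds: proved by `Summit.NavierStokesRegularity.NavierStokesRegularity.Theorems.typeICertificateLadder_noBlowupToClay_proof` @ 8d57e70af7e2. -/
theorem Assembly_holds : Assembly := _root_.Summit.NavierStokesRegularity.NavierStokesRegularity.Theorems.typeICertificateLadder_noBlowupToClay_proof

-- TODO item stmt-NavierStokesRegularity-0061 · assembly · rank 1 · closed · moot by None · by planner — BLOCKED: missing decl(s) Literature.NS.CriticalLyapunov; restate via `ledger route edit` once they land:
--   def Assembly2 : Prop := Literature.Analysis.FluidPDE.hasSmoothExtensionPast_of_eLpNorm_three_bounded → Nonempty Literature.NS.CriticalLyapunov → ∀ (ν T : ℝ), 0 < ν → 0 < T → ∀ (u : ℝ → EuclideanSpace ℝ (Fin 3) → EuclideanSpace ℝ (Fin 3)) (p : ℝ → EuclideanSpace ℝ (Fin 3) → ℝ), Literature.Analysis.FluidPDE.IsClassicalNSSolu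

end Summit.NavierStokesRegularity.NavierStokesRegularity.Theses.MonotoneCritical
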